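import Literature.MathematicalPhysics.QuantumLattice.HubbardHighTemperatureMomentum
import Literature.MathematicalPhysics.QuantumLattice.HubbardLatticeAnalytic
import Literature.MathematicalPhysics.QuantumLattice.HubbardTwoPointSource
import Mathlib.Analysis.Complex.LocallyUniformLimit
import HarnessLib

/-!
# Analyticity in the coupling of the high-temperature two-point function, uniformly in the volume

Continuation of `HubbardHighTemperatureTwoPoint.lean` (the high-temperature corner of the fact
`bgm_two_point_limit`). There the source-gas cluster expansion is run for REAL `U, μ`; here the same
expansion is run for COMPLEX `(U, μ)` in the domain where the one-site partition function
`z₀ = 1 + 2e^{βμ} + e^{-β(U-2μ)}` does not vanish and the site ratio `Σ|e^{-βE}|/|z₀|` is `≤ 2`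
(section `Generic`–`Torus`: the complex-parameter twins `srcActivityC`, `srcLogZC`, `srcMainC`,
`srcTailC` of the real definitions, with the same proofs at site ratio `2` instead of `1`, hence at
the threshold `β₁ = betaHTc = betaHT/4`; the real definitions are the special case
`srcActivityC G β ↑U ↑μ = srcActivity G β U μ`, `srcActivityC_ofReal`). Consequences:

* `SourceGasC.twoPtC` — the finite-volume two-point function `Tr(e^{-βH_L(U,μ)} c†_{0̄σ}c_{ȳσ}) / Tr e^{-βH_L(U,μ)}`
  for complex `U, μ` (bond-algebra form), equal to `hubbardThermalTwoPoint` at real parameters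
  (`twoPtC_ofReal`);
* `SourceGasC.norm_twoPtC_sub_le` — it is Cauchy in `L` UNIFORMLY on the admissible domain;
* for real `0 ≤ β ≤ β₁`, real `μ` and complex `U` in the strip `|β Im U| < π/3` the parameters are
  admissible (`admissible_of_mem_strip`), `U ↦ twoPtC` is holomorphic on the strip for every `L`
  (`differentiableOn_twoPtC`), hence the thermodynamic limit `htTwoPointLimitC β μ σ z U` exists
  on the strip, is HOLOMORPHIC there (`differentiableOn_htTwoPointLimitC`, uniform limits of
  holomorphic functions) and extends the real high-temperature two-point function
  (`htTwoPointLimitC_ofReal`): **at high temperature the perturbation series in `U` of the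
  infinite-volume two-point function converges for `|U| < π/(3β)`** (`hasFPowerSeriesOnBall_htTwoPointLimitC`)
  — the elementary `O(β⁻¹)` radius which the renormalisation group of Benfatto–Giuliani–Mastropietro
  improves to `O(1/log β)` in the Fermi-liquid regime of the fact.

RELATION TO `HubbardHighTemperatureTwoPoint.lean` (for a librarian pass). Sections `Generic`,
`Transport`, `Torus` and the first half of `Limit` below are the complex-`(U, μ)` TWINS of the
declarations of the same names without the suffix `C` in that file (`srcActivityC`, `srcLogZC`,
`srcMainC`, `srcTailC`, `isSmallActivity_srcActivityC`, `norm_srcTailC_le`, `srcMainC_eq_of_transport`,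
`srcMainC_torus_eq_plane`, `norm_srcLogZC_sub_sub_le`, …): same statements and proofs with the two
extra hypotheses `z₀ ≠ 0`, site ratio `≤ 2` and the threshold `betaHTc = betaHT/4` in place of
`betaHT`. The real declarations are definitionally the special case of real `U, μ`
(`srcActivityC_ofReal`, `srcLogZC_ofReal`, by `rfl`), where the extra hypotheses hold
(`admissible_ofReal`); the real file should eventually be re-derived from this one (at the cost of
the factor `4` in the threshold, or by threading the site ratio as a parameter). What is NEW here is
everything from `twoPtC` on: the complex-parameter two-point function, its volume-uniform Cauchy
estimate on the admissible domain, the admissibility of the strip `|β Im U| < π/3`, and the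
holomorphy / power-series statements for the thermodynamic limit.

## References

* D. Ueltschi, J. Stat. Phys. 95 (1999) 693, Thm. 2.1 (i)–(ii) (analyticity of the weights in the
  parameters, "Φ^T(C) is analytic … by Vitali theorem") and §3. [Ueltschi1999]
* R. Kotecký, D. Preiss, Commun. Math. Phys. 103 (1986) 491. [KoteckyPreiss1986]
* G. Benfatto, A. Giuliani, V. Mastropietro, Ann. Henri Poincaré 7 (2006) 809, §1.3 (the radius of
  convergence in `U` of the naive expansion shrinks as `β → ∞`). [BenfattoGiulianiMastropietro2006]
-/

noncomputable section

namespace Literature.MathematicalPhysics.QuantumLattice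

open Matrix Finset HubbardWave0 Literature.Probability.LatticeModels Filter SourceGas
open scoped _root_.Topology Matrix.Norms.L2Operator

namespace SourceGasC

/-! ### The threshold `β₁ = β₀/4` and the admissible complex parameters -/

/-- `β₁ = betaHT / 4`: the smallness needed at site ratio `2`. [folklore] -/
def betaHTc : ℝ := betaHT / 4

/-- `β₁ > 0`. [folklore] -/
theorem betaHTc_pos : 0 < betaHTc := div_pos betaHT_pos (by norm_num)

/-- `β₁ ≤ β₀`. [folklore] -/
theorem betaHTc_le_betaHT : betaHTc ≤ betaHT := by
  unfold betaHTc; linarith [betaHT_pos]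

/-- `2β₁ ≤ 1`. [folklore] -/
theorem two_mul_betaHTc_le_one : 2 * betaHTc ≤ 1 := by
  have := two_mul_betaHT_le_one; unfold betaHTc; linarith [betaHT_pos]

/-- The smallness hypothesis of `sum_norm_couplingActivity_mul_exp_le` at `m = 17`, `r₀ = 2`,
`δ = 2β₁`. [folklore] -/
theorem smallness_betaHTc : ((2 * 17 : ℕ) + 1 : ℝ) ^ 2 * (Real.exp 6 * 2 ^ 2 * (2 * betaHTc)) ≤ 1 / 2 := by
  have h := smallness_betaHT
  have e : Real.exp 6 * 2 ^ 2 * (2 * betaHTc) = Real.exp 6 * 1 ^ 2 * (2 * betaHT) := by unfold betaHTc; ring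
  rwa [e]

/-- And `2 · 17 · λ ≤ 1`. [folklore] -/
theorem two_mul_seventeen_mul_le_one_c : 2 * 17 * (Real.exp 6 * 2 ^ 2 * (2 * betaHTc)) ≤ 1 := by
  have h := two_mul_seventeen_mul_le_one
  have e : Real.exp 6 * 2 ^ 2 * (2 * betaHTc) = Real.exp 6 * 1 ^ 2 * (2 * betaHT) := by unfold betaHTc; ring
  rwa [e]

/-- **Real parameters are admissible**: `z₀ ≠ 0` and site ratio `= 1 ≤ 2`. [folklore] -/
theorem admissible_ofReal (β U μ : ℝ) :
    atomicPartitionFn (β : ℂ) (U : ℂ) (μ : ℂ) ≠ 0 ∧ siteRatio (β : ℂ) (U : ℂ) (μ : ℂ) ≤ 2 :=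
  ⟨atomicPartitionFn_real_ne_zero β U μ, (siteRatio_ofReal β U μ).le.trans one_le_two⟩

/-- **The strip `|β Im U| ≤ π/3` is admissible** for real `β` and real `μ`: there
`Re z₀ ≥ ½ Σ_E |e^{-βE}|`, so `z₀ ≠ 0` and the site ratio is `≤ 2`. [folklore] -/
theorem admissible_of_abs_mul_im_le {β : ℝ} (μ : ℝ) {U : ℂ} (hU : |β * U.im| ≤ Real.pi / 3) :
    atomicPartitionFn (β : ℂ) U (μ : ℂ) ≠ 0 ∧ siteRatio (β : ℂ) U (μ : ℂ) ≤ 2 := by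
  set a : ℝ := Real.exp (β * μ) with ha
  set d : ℝ := Real.exp (-(β * U.re - 2 * (β * μ))) with hd
  have ha0 : 0 < a := Real.exp_pos _
  have hd0 : 0 < d := Real.exp_pos _
  -- `cos (β Im U) ≥ 1/2`
  have hcos : (1 : ℝ) / 2 ≤ Real.cos (β * U.im) := by
    rw [← Real.cos_abs, ← Real.cos_pi_div_three]
    exact Real.cos_le_cos_of_nonneg_of_le_pi (abs_nonneg _) (by linarith [Real.pi_pos]) hU
  -- the two exponentials
  have h1 : Complex.exp ((β : ℂ) * (μ : ℂ)) = (a : ℂ) := by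
    rw [← Complex.ofReal_mul, ← Complex.ofReal_exp]
  have hw_re : (-((β : ℂ) * (U - 2 * (μ : ℂ)))).re = -(β * U.re - 2 * (β * μ)) := by
    simp only [Complex.neg_re, Complex.mul_re, Complex.ofReal_re, Complex.ofReal_im, Complex.sub_re, Complex.sub_im,
      Complex.re_ofNat, Complex.im_ofNat, zero_mul, sub_zero, mul_zero]
    ring
  have hw_im : (-((β : ℂ) * (U - 2 * (μ : ℂ)))).im = -(β * U.im) := by
    simp only [Complex.neg_im, Complex.mul_im, Complex.ofReal_re, Complex.ofReal_im, Complex.sub_re, Complex.sub_im,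
      Complex.re_ofNat, Complex.im_ofNat, zero_mul, sub_zero, mul_zero, add_zero]
  have h2 : (Complex.exp (-((β : ℂ) * (U - 2 * (μ : ℂ))))).re = d * Real.cos (β * U.im) := by
    rw [Complex.exp_re, hw_re, hw_im, Real.cos_neg]
  -- real part of `z₀`
  have hre : (atomicPartitionFn (β : ℂ) U (μ : ℂ)).re = 1 + 2 * a + d * Real.cos (β * U.im) := by
    rw [atomicPartitionFn, h1, Complex.add_re, Complex.add_re, h2]
    norm_num
  -- the numerator of the site ratio
  have hnum : atomicPartitionFnReal 1 ((β : ℂ) * U).re ((β : ℂ) * (μ : ℂ)).re = 1 + 2 * a + d := by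
    have e1 : ((β : ℂ) * U).re = β * U.re := by simp [Complex.mul_re]
    have e2 : ((β : ℂ) * (μ : ℂ)).re = β * μ := by rw [← Complex.ofReal_mul, Complex.ofReal_re]
    rw [atomicPartitionFnReal, e1, e2, one_mul, one_mul]
  have hre_ge : (1 + 2 * a + d) / 2 ≤ (atomicPartitionFn (β : ℂ) U (μ : ℂ)).re := by
    rw [hre]; nlinarith
  have hnorm_ge : (1 + 2 * a + d) / 2 ≤ ‖atomicPartitionFn (β : ℂ) U (μ : ℂ)‖ := hre_ge.trans (Complex.re_le_norm _)
  have hpos : 0 < (1 + 2 * a + d) / 2 := by positivity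
  have hz : atomicPartitionFn (β : ℂ) U (μ : ℂ) ≠ 0 := fun h => by
    rw [h, norm_zero] at hnorm_ge; linarith
  refine ⟨hz, ?_⟩
  rw [siteRatio, hnum, div_le_iff₀ (norm_pos_iff.2 hz)]
  linarith

/-- The strip of couplings `{U ∈ ℂ : |β Im U| < π/3}` (all of `ℂ` at `β = 0`). [folklore] -/
def strip (β : ℝ) : Set ℂ := {U | |β * U.im| < Real.pi / 3}

/-- The strip is open. [folklore] -/
theorem isOpen_strip (β : ℝ) : IsOpen (strip β) :=
  isOpen_lt (continuous_abs.comp (continuous_const.mul Complex.continuous_im)) continuous_const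

/-- Real couplings lie in the strip. [folklore] -/
theorem ofReal_mem_strip (β U : ℝ) : (U : ℂ) ∈ strip β := by
  show |β * (U : ℂ).im| < Real.pi / 3
  rw [Complex.ofReal_im, mul_zero, abs_zero]
  positivity

/-- The disc `|U| < π/(3β)` lies in the strip (`β > 0`). [folklore] -/
theorem ball_subset_strip {β : ℝ} (hβ : 0 < β) : Metric.ball (0 : ℂ) (Real.pi / 3 / β) ⊆ strip β := by
  intro U hU
  rw [Metric.mem_ball, dist_zero_right] at hU
  show |β * U.im| < Real.pi / 3
  rw [abs_mul, abs_of_pos hβ]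
  have him : |U.im| ≤ ‖U‖ := Complex.abs_im_le_norm U
  calc β * |U.im| ≤ β * ‖U‖ := mul_le_mul_of_nonneg_left him hβ.le
    _ < β * (Real.pi / 3 / β) := mul_lt_mul_of_pos_left hU hβ
    _ = Real.pi / 3 := by field_simp

/-- Points of the strip are admissible. [folklore] -/
theorem admissible_of_mem_strip {β : ℝ} (μ : ℝ) {U : ℂ} (hU : U ∈ strip β) :
    atomicPartitionFn (β : ℂ) U (μ : ℂ) ≠ 0 ∧ siteRatio (β : ℂ) U (μ : ℂ) ≤ 2 :=
  admissible_of_abs_mul_im_le μ (le_of_lt hU)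

/-! ### The complex-parameter source gas -/

section Generic

variable {Λ : Type*} [LinearOrder Λ] [Fintype Λ]

/-- The polymer activities of the source gas for complex `U, μ` (real `β`): the complex-parameter
twin of `SourceGas.srcActivity`. [cite: Ueltschi1999, §2.3 and proof of Thm. 2.1 (ii) (ρ, ρ_K)] -/
def srcActivityC (G : SimpleGraph Λ) [DecidableRel G.Adj] (β : ℝ) (U μ : ℂ) (b₀ : Bond Λ) (ε : ℂ) : Finset Λ → ℂ :=
  couplingActivity (srcBonds G b₀) (β : ℂ) U μ (srcCoupling G β b₀ ε)

/-- The Kotecký–Preiss logarithm of the complex-parameter source gas. [cite: KoteckyPreiss1986, §2 (log 𝒵)] -/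
def srcLogZC (G : SimpleGraph Λ) [DecidableRel G.Adj] (β : ℝ) (U μ : ℂ) (b₀ : Bond Λ) (ε : ℂ) : ℂ :=
  polymerLogZ polyInc (srcActivityC G β U μ b₀ ε) (Finset.univ : Finset Λ).powerset

variable {G : SimpleGraph Λ} [DecidableRel G.Adj] {β : ℝ} {U μ : ℂ} {b₀ : Bond Λ}

/-- At real parameters the complex-parameter activities are the real ones. [folklore] -/
@[simp] theorem srcActivityC_ofReal (U μ : ℝ) (ε : ℂ) : srcActivityC G β (U : ℂ) (μ : ℂ) b₀ ε = srcActivity G β U μ b₀ ε := rfl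

/-- At real parameters the complex-parameter logarithm is the real one. [folklore] -/
@[simp] theorem srcLogZC_ofReal (U μ : ℝ) : srcLogZC G β (U : ℂ) (μ : ℂ) b₀ = srcLogZ G β U μ b₀ := rfl

/-- **The polymer representation of the source-inserted Gibbs factor**: `Zc(c^ε) = z₀^{|Λ|} Ξ(ρ^ε)`.
[cite: Ueltschi1999, §2.3 (polymer form of Tr e^{-βH_Λ})] -/
theorem Zc_srcCouplingC (hz : atomicPartitionFn (β : ℂ) U μ ≠ 0) (ε : ℂ) :
    Zc (β : ℂ) U μ (srcCoupling G β b₀ ε) =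
      atomicPartitionFn (β : ℂ) U μ ^ Fintype.card Λ *
        polymerPartitionFunction polyInc (srcActivityC G β U μ b₀ ε) (Finset.univ : Finset Λ).powerset := by
  rw [← couplingRestrict_srcCoupling ε, Zc_couplingRestrict_eq_mul_polymerPartitionFunction hz]
  rfl

/-! ### Bond counts and smallness -/


/-- **Smallness of the activities**: if degrees are `≤ 4`, `0 ≤ β ≤ β₀` and `|ε| ≤ β₀`, the activities
of the source gas form a small activity with `δ = 1` for COMPLEX `U, μ` with `z₀ ≠ 0` and site ratio `≤ 2`,
`0 ≤ β ≤ β₁ = β₀/4`, `|ε| ≤ β₁` (uniformly in the volume and `b₀`).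
[cite: Ueltschi1999, §3 (|ρ(𝒜)| ≤ e^{-c|𝒜|} for βt small) and proof of Thm. 2.1 (ii) (bound on ρ_K)] -/
theorem isSmallActivity_srcActivityC (hdeg : ∀ v : Λ, (Finset.univ.filter (G.Adj v)).card ≤ 4)
    (hz : atomicPartitionFn (β : ℂ) U μ ≠ 0) (hr : siteRatio (β : ℂ) U μ ≤ 2) (hβ0 : 0 ≤ β) (hβ : β ≤ betaHTc) {ε : ℂ} (hε : ‖ε‖ ≤ betaHTc) :
    IsSmallActivity (srcActivityC G β U μ b₀ ε) 1 where
  rho_empty := couplingActivity_empty _ _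
  delta_pos := one_pos
  sum_le_one x 𝒜 h𝒜 := by
    have hδ0 : 0 < 2 * betaHTc := by linarith [betaHTc_pos]
    have hc : ∀ b ∈ srcBonds G b₀, ‖srcCoupling G β b₀ ε b‖ ≤ 2 * betaHTc := fun b _ =>
      (norm_srcCoupling_le hβ0 ε b).trans (by linarith)
    have h := sum_norm_couplingActivity_mul_exp_le (D := srcBonds G b₀) (m := 17) (card_filter_srcBonds_le hdeg)
      hz (by norm_num) hr hδ0 two_mul_betaHTc_le_one hc smallness_betaHTc x 𝒜 h𝒜
    refine le_trans ?_ (h.trans two_mul_seventeen_mul_le_one_c)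
    refine le_of_eq (Finset.sum_congr rfl fun A _ => ?_)
    rw [srcActivityC, show ((1 : ℝ) + 1) * (A.card : ℝ) = 2 * A.card by ring]

/-- Polymers with non-zero activity are connected through the active bonds. [folklore] -/
theorem isRConnected_of_srcActivityC_ne_zero {ε : ℂ} {A : Finset Λ} (hA : srcActivityC G β U μ b₀ ε A ≠ 0) :
    IsRConnected (BondRel (srcBonds G b₀)) A :=
  isRConnected_bondRel_of_couplingActivity_ne_zero hA

/-! ### Analyticity in the source -/

/-- The activities are entire functions of the source strength. [cite: KoteckyPreiss1986, p. 493 ("Φ analytic in some parameter")] -/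
theorem differentiable_srcActivityC (A : Finset Λ) : Differentiable ℂ fun ε : ℂ => srcActivityC G β U μ b₀ ε A := by
  unfold srcActivityC
  simp only [couplingActivity_apply, couplingWeight_eq_sum]
  refine Differentiable.fun_sum fun X _ => Differentiable.fun_sum fun K' _ => ?_
  refine (differentiable_const _).mul ?_
  simp_rw [couplingRestrict_srcCoupling_eq]
  have hlin : Differentiable ℂ fun ε : ℂ =>
      couplingRestrict (hubbardCoupling G (β : ℂ)) K' + ε • couplingRestrict (Pi.single b₀ 1 : Bond Λ → ℂ) K' :=
    (differentiable_const _).add (differentiable_id.smul_const _)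
  exact (differentiable_gibbsRatio (β : ℂ) U μ).comp hlin

/-- Along the rays `u · ρ^ε`, `u ∈ [0, 1]`, `|ε| ≤ β₀`, no partition function vanishes. [cite: KoteckyPreiss1986, Theorem p. 492 (Z ≠ 0)] -/
theorem polymerPartitionFunction_ray_ne_zeroC (hdeg : ∀ v : Λ, (Finset.univ.filter (G.Adj v)).card ≤ 4)
    (hz : atomicPartitionFn (β : ℂ) U μ ≠ 0) (hr : siteRatio (β : ℂ) U μ ≤ 2) (hβ0 : 0 ≤ β) (hβ : β ≤ betaHTc) {ε : ℂ} (hε : ‖ε‖ ≤ betaHTc)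
    {u : ℝ} (hu : u ∈ Set.Icc (0 : ℝ) 1) (𝒱 : Finset (Finset Λ)) :
    polymerPartitionFunction polyInc (fun A => (u : ℂ) * srcActivityC G β U μ b₀ ε A) 𝒱 ≠ 0 := by
  have hsm := isSmallActivity_srcActivityC (U := U) (μ := μ) (b₀ := b₀) hdeg hz hr hβ0 hβ hε
  have hKP := IsKPVolume.of_norm_le (hsm.isKPVolume 𝒱)
    (w' := fun A => (u : ℂ) * srcActivityC G β U μ b₀ ε A) fun A _ => by
      rw [norm_mul, Complex.norm_real, Real.norm_eq_abs, abs_of_nonneg hu.1]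
      exact mul_le_of_le_one_left (norm_nonneg _) hu.2
  exact polymerPartitionFunction_ne_zero_of_kp hKP Finset.Subset.rfl

/-- **`F` is complex-differentiable on `|ε| < β₀`.** [cite: KoteckyPreiss1986, p. 493 (analyticity of log Z)] -/
theorem differentiableOn_srcLogZC (hdeg : ∀ v : Λ, (Finset.univ.filter (G.Adj v)).card ≤ 4) (hz : atomicPartitionFn (β : ℂ) U μ ≠ 0) (hr : siteRatio (β : ℂ) U μ ≤ 2) (hβ0 : 0 ≤ β) (hβ : β ≤ betaHTc) :
    DifferentiableOn ℂ (srcLogZC G β U μ b₀) (Metric.ball 0 betaHTc) := by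
  refine differentiableOn_polymerLogZ_param (inc := polyInc) (v := fun ε A => srcActivityC G β U μ b₀ ε A)
    (Finset.univ : Finset Λ).powerset Metric.isOpen_ball
    (fun A _ => (differentiable_srcActivityC A).differentiableOn) fun ε hε u hu => ?_
  exact polymerPartitionFunction_ray_ne_zeroC hdeg hz hr hβ0 hβ (le_of_lt (by simpa using hε)) hu _

/-- `exp F(ε) · z₀^{|Λ|} = Zc(c^ε)` for `|ε| ≤ β₀`. [cite: KoteckyPreiss1986, Theorem p. 492 ((2) and Z ≠ 0)] -/
theorem exp_srcLogZC_mul (hdeg : ∀ v : Λ, (Finset.univ.filter (G.Adj v)).card ≤ 4) (hz : atomicPartitionFn (β : ℂ) U μ ≠ 0) (hr : siteRatio (β : ℂ) U μ ≤ 2) (hβ0 : 0 ≤ β) (hβ : β ≤ betaHTc)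
    {ε : ℂ} (hε : ‖ε‖ ≤ betaHTc) :
    Complex.exp (srcLogZC G β U μ b₀ ε) * atomicPartitionFn (β : ℂ) U μ ^ Fintype.card Λ =
      Zc (β : ℂ) U μ (srcCoupling G β b₀ ε) := by
  rw [srcLogZC, (isSmallActivity_srcActivityC (U := U) (μ := μ) hdeg hz hr hβ0 hβ hε).exp_polymerLogZ, Zc_srcCouplingC hz, mul_comm]


/-! ### The anchored decomposition and the tails -/

/-- The main part: anchored families of size `< R`. [cite: Ueltschi1999, proof of Thm. 2.1 (iii) ("short" polymers and clusters)] -/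
def srcMainC (G : SimpleGraph Λ) [DecidableRel G.Adj] (β : ℝ) (U μ : ℂ) (b₀ : Bond Λ) (R : ℕ) (ε : ℂ) : ℂ :=
  ∑ C ∈ (srcFamilies b₀).filter (fun C => famSize C < R), truncatedWeight polyInc (srcActivityC G β U μ b₀ ε) C

/-- The tail: anchored families of size `≥ R`. [cite: Ueltschi1999, proof of Thm. 2.1 (iii) ("big" polymers and clusters)] -/
def srcTailC (G : SimpleGraph Λ) [DecidableRel G.Adj] (β : ℝ) (U μ : ℂ) (b₀ : Bond Λ) (R : ℕ) (ε : ℂ) : ℂ :=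
  ∑ C ∈ (srcFamilies b₀).filter (fun C => R ≤ famSize C), truncatedWeight polyInc (srcActivityC G β U μ b₀ ε) C


/-- Off the anchored polymers the activities do not see the source. [cite: Ueltschi1999, proof of Thm. 2.1 (ii)] -/
theorem srcActivityC_eq_of_not_mem_anchored {A : Finset Λ} (hA : A ∉ srcAnchored b₀) (ε ε' : ℂ) :
    srcActivityC G β U μ b₀ ε A = srcActivityC G β U μ b₀ ε' A :=
  couplingActivity_congr_of_not_subset (b₀ := b₀) (fun _ hb => srcCoupling_eq_of_ne hb) (fun h => hA (mem_srcAnchored.2 h))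

/-- **The anchored difference formula**: `F(ε) - F(ε') = Σ_{C anchored} (Φ^T(C; ρ^ε) - Φ^T(C; ρ^{ε'}))`.
[cite: KoteckyPreiss1986, (2) and Proposition p. 494 (i)] -/
theorem srcLogZC_sub (ε ε' : ℂ) :
    srcLogZC G β U μ b₀ ε - srcLogZC G β U μ b₀ ε' =
      ∑ C ∈ srcFamilies b₀, (truncatedWeight polyInc (srcActivityC G β U μ b₀ ε) C - truncatedWeight polyInc (srcActivityC G β U μ b₀ ε') C) := by
  rw [srcLogZC, srcLogZC, polymerLogZ_sub_eq_sum_filter _ (srcAnchored b₀) (fun A _ hA => srcActivityC_eq_of_not_mem_anchored hA ε ε')]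
  rfl

/-- Main part plus tail. [folklore] -/
theorem srcLogZC_sub_eq_main_add_tail (R : ℕ) (ε ε' : ℂ) :
    srcLogZC G β U μ b₀ ε - srcLogZC G β U μ b₀ ε' =
      (srcMainC G β U μ b₀ R ε - srcMainC G β U μ b₀ R ε') + (srcTailC G β U μ b₀ R ε - srcTailC G β U μ b₀ R ε') := by
  rw [srcLogZC_sub, Finset.sum_sub_distrib, srcMainC, srcMainC, srcTailC, srcTailC]
  have hsplit : ∀ f : Finset (Finset Λ) → ℂ, ∑ C ∈ srcFamilies b₀, f C =
      ∑ C ∈ (srcFamilies b₀).filter (fun C => famSize C < R), f C + ∑ C ∈ (srcFamilies b₀).filter (fun C => R ≤ famSize C), f C := by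
    intro f
    rw [← Finset.sum_filter_add_sum_filter_not (srcFamilies b₀) (fun C => famSize C < R)]
    congr 1
    exact Finset.sum_congr (Finset.filter_congr fun C _ => not_lt) fun _ _ => rfl
  rw [hsplit, hsplit]
  ring


/-- **The tail bound**: `|tail(R, ε)| ≤ e^{-R}` for degrees `≤ 4`, `0 ≤ β ≤ β₀`, `|ε| ≤ β₀` (the
Kotecký–Preiss estimate at the one-site polymer `{b₀.1}`). [cite: KoteckyPreiss1986, Theorem p. 492, estimate (4)] -/
theorem norm_srcTailC_le [Countable Λ] (hdeg : ∀ v : Λ, (Finset.univ.filter (G.Adj v)).card ≤ 4) (hz : atomicPartitionFn (β : ℂ) U μ ≠ 0) (hr : siteRatio (β : ℂ) U μ ≤ 2) (hβ0 : 0 ≤ β) (hβ : β ≤ betaHTc)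
    {ε : ℂ} (hε : ‖ε‖ ≤ betaHTc) (R : ℕ) :
    ‖srcTailC G β U μ b₀ R ε‖ ≤ Real.exp (-R) := by
  have hsmall := isSmallActivity_srcActivityC (U := U) (μ := μ) (b₀ := b₀) hdeg hz hr hβ0 hβ hε
  have h := hsmall.sum_norm_truncatedWeight_anchored_ge_le b₀.1 (srcFamilies b₀) R
  rw [one_mul] at h
  refine (norm_sum_le _ _).trans (le_trans ?_ h)
  refine Finset.sum_le_sum_of_subset_of_nonneg (fun C hC => ?_) fun _ _ _ => norm_nonneg _
  obtain ⟨hC, hsize⟩ := Finset.mem_filter.1 hC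
  refine Finset.mem_filter.2 ⟨hC, fst_mem_clusterSupp hC, ?_⟩
  rw [← Nat.cast_sum]
  exact_mod_cast hsize

/-! ### Geometry: anchored families of bounded size stay near the source -/

/-- **Anchored families of size `< ‖C‖` stay within height `< ‖C‖`.** Let `ht` grow by at most one
along the edges of `G` and vanish at both sites of `b₀`. If `Φ^T(C; ρ^ε) ≠ 0` for an anchored family

/-! ### Geometry: anchored families of bounded size stay near the source -/

[cite: Ueltschi1999, proof of Thm. 2.1 (iii) (polymers and clusters of connected cardinality < d/4)] -/
theorem height_lt_of_mem_srcFamiliesC (hdeg : ∀ v : Λ, (Finset.univ.filter (G.Adj v)).card ≤ 4) (hz : atomicPartitionFn (β : ℂ) U μ ≠ 0) (hr : siteRatio (β : ℂ) U μ ≤ 2) (hβ0 : 0 ≤ β) (hβ : β ≤ betaHTc)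
    {ε : ℂ} (hε : ‖ε‖ ≤ betaHTc) {ht : Λ → ℕ} (hlip : ∀ a b, G.Adj a b → ht b ≤ ht a + 1)
    (h1 : ht b₀.1 = 0) (h2 : ht b₀.2.1 = 0) {C : Finset (Finset Λ)} (hC : C ∈ srcFamilies b₀)
    (hne : truncatedWeight polyInc (srcActivityC G β U μ b₀ ε) C ≠ 0) {w : Λ} (hw : w ∈ clusterSupp C) :
    ht w < famSize C := by
  have hsmall := isSmallActivity_srcActivityC (U := U) (μ := μ) (b₀ := b₀) hdeg hz hr hβ0 hβ hε
  refine hsmall.height_lt_of_mem_clusterSupp (R := BondRel (srcBonds G b₀)) (fun A hA => isRConnected_of_srcActivityC_ne_zero hA)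
    (fun a b hab => ?_) hne (fst_mem_clusterSupp hC) h1 hw
  obtain ⟨bd, hbd, ha, hb⟩ := hab
  simp only [Bond.verts, Finset.mem_insert, Finset.mem_singleton] at ha hb
  rcases mem_srcBonds.1 hbd with hadj | rfl
  · rcases ha with rfl | rfl <;> rcases hb with rfl | rfl
    · exact Nat.le_succ _
    · exact hlip _ _ hadj
    · exact hlip _ _ hadj.symm
    · exact Nat.le_succ _
  · have hb0 : ht b = 0 := by rcases hb with rfl | rfl <;> assumption
    omega

/-! ### The finite-volume two-point function for complex parameters -/

/-- The **finite-volume two-point function for complex `U, μ`** in bond-algebra form: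
`Z'(0)/Z(0)` for `Z(ε) = Zc(c^ε) = Tr exp(-βV_{U,μ} + Σ c^ε T)`, i.e.
`Tr(e^{-βH_G(U,μ)} c†_{b₀.1 σ} c_{b₀.2 σ}) / Tr e^{-βH_G(U,μ)}`; at real parameters it is the thermal
expectation of the fact (`twoPtC_ofReal`). [cite: Ueltschi1999, §2.1 (Gibbs state ⟨K⟩)] -/
def twoPtC (G : SimpleGraph Λ) [DecidableRel G.Adj] (β : ℝ) (U μ : ℂ) (b₀ : Bond Λ) : ℂ :=
  deriv (fun ε : ℂ => Zc (β : ℂ) U μ (srcCoupling G β b₀ ε)) 0 / Zc (β : ℂ) U μ (srcCoupling G β b₀ 0)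

/-- **`F'(0)` is the two-point function** for admissible complex parameters. [cite: Ueltschi1999, proof of Thm. 2.1 (ii)] -/
theorem deriv_srcLogZC_zero (hdeg : ∀ v : Λ, (Finset.univ.filter (G.Adj v)).card ≤ 4)
    (hz : atomicPartitionFn (β : ℂ) U μ ≠ 0) (hr : siteRatio (β : ℂ) U μ ≤ 2) (hβ0 : 0 ≤ β) (hβ : β ≤ betaHTc) :
    deriv (srcLogZC G β U μ b₀) 0 = twoPtC G β U μ b₀ := by
  have hball : Metric.ball (0 : ℂ) betaHTc ∈ 𝓝 (0 : ℂ) := Metric.ball_mem_nhds 0 betaHTc_pos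
  have hF : DifferentiableAt ℂ (srcLogZC G β U μ b₀) 0 := (differentiableOn_srcLogZC hdeg hz hr hβ0 hβ).differentiableAt hball
  have hZ0 : Zc (β : ℂ) U μ (srcCoupling G β b₀ 0) ≠ 0 := by
    rw [← exp_srcLogZC_mul (U := U) (μ := μ) hdeg hz hr hβ0 hβ (by rw [norm_zero]; exact betaHTc_pos.le)]
    exact mul_ne_zero (Complex.exp_ne_zero _) (pow_ne_zero _ hz)
  have hev : ∀ᶠ ε in 𝓝 (0 : ℂ), Complex.exp (srcLogZC G β U μ b₀ ε) * atomicPartitionFn (β : ℂ) U μ ^ Fintype.card Λ =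
      Zc (β : ℂ) U μ (srcCoupling G β b₀ ε) := by
    filter_upwards [hball] with ε hε
    exact exp_srcLogZC_mul hdeg hz hr hβ0 hβ (le_of_lt (by simpa using hε))
  rw [twoPtC, deriv_eq_deriv_div_of_exp_mul_eq hF hZ0 hev]

/-- `Z(0) ≠ 0` for admissible parameters. [cite: KoteckyPreiss1986, Theorem p. 492 (Z ≠ 0)] -/
theorem Zc_srcCoupling_zero_ne_zero (hdeg : ∀ v : Λ, (Finset.univ.filter (G.Adj v)).card ≤ 4)
    (hz : atomicPartitionFn (β : ℂ) U μ ≠ 0) (hr : siteRatio (β : ℂ) U μ ≤ 2) (hβ0 : 0 ≤ β) (hβ : β ≤ betaHTc) :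
    Zc (β : ℂ) U μ (srcCoupling G β b₀ 0) ≠ 0 := by
  rw [← exp_srcLogZC_mul (U := U) (μ := μ) hdeg hz hr hβ0 hβ (by rw [norm_zero]; exact betaHTc_pos.le)]
  exact mul_ne_zero (Complex.exp_ne_zero _) (pow_ne_zero _ hz)

/-- The numerator and denominator of `twoPtC` in closed form: with
`X(U, μ) = -β V_{U,μ} + Σ_{G} β T`, `twoPtC = Tr(e^{X} T_{b₀}) / Tr e^{X}`. [cite: DLS1978, §3] -/
theorem twoPtC_eq_trace_div (β : ℝ) (U μ : ℂ) (b₀ : Bond Λ) :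
    twoPtC G β U μ b₀ =
      (NormedSpace.exp (-((β : ℂ) • onSiteSum U μ (Finset.univ : Finset Λ)) + hopSum (hubbardCoupling G (β : ℂ))) * bondOp b₀).trace /
        (NormedSpace.exp (-((β : ℂ) • onSiteSum U μ (Finset.univ : Finset Λ)) + hopSum (hubbardCoupling G (β : ℂ)))).trace := by
  unfold twoPtC srcCoupling
  rw [deriv_Zc_add_smul_single_zero, zero_smul, add_zero, Zc]

end Generic

/-! ### Transport and comparison with the plane -/

section Transport

variable {Λ Λ' : Type*} [LinearOrder Λ] [Fintype Λ] [LinearOrder Λ'] [Fintype Λ']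
variable {G : SimpleGraph Λ} [DecidableRel G.Adj] {G' : SimpleGraph Λ'} [DecidableRel G'.Adj]
variable (φ : Λ ↪ Λ') {b₀ : Bond Λ} {b₀' : Bond Λ'} {β : ℝ} {U μ : ℂ}

/-- **Transport of the activities**: along an injective site map `φ` carrying the edges of `G` onto
the edges of `G'` among image points and `b₀` to `b₀'`, `ρ'(φ A) = ρ(A)` for every polymer `A`.
[cite: Ueltschi1999, §2.3 (ρ(𝒜) only involves the sites of 𝒜; periodic weights)] -/
theorem srcActivityC_map_inj (hz : atomicPartitionFn (β : ℂ) U μ ≠ 0) (hG : ∀ p q, G'.Adj (φ p) (φ q) ↔ G.Adj p q) (hb : bondMapInj φ b₀ = b₀') (ε : ℂ) (A : Finset Λ) :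
    srcActivityC G' β U μ b₀' ε (A.map φ) = srcActivityC G β U μ b₀ ε A := by
  refine couplingActivity_map_inj φ hz (fun b' hb' => ?_) (fun b' hb' h1 h2 => ?_)
    (fun b _ => srcCoupling_bondMapInj φ hG hb ε b) A
  · obtain ⟨b, hbD, rfl⟩ := Finset.mem_map.1 hb'
    rcases mem_srcBonds.1 hbD with hadj | rfl
    · exact mem_srcBonds.2 (Or.inl (by rw [bondMapInj_apply]; exact (hG _ _).2 hadj))
    · exact mem_srcBonds.2 (Or.inr hb)
  · obtain ⟨p, -, hp⟩ := Finset.mem_map.1 h1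
    obtain ⟨q, -, hq⟩ := Finset.mem_map.1 h2
    have hb'eq : b' = bondMapInj φ (p, q, b'.2.2) := by
      rw [bondMapInj_apply, hp, hq]
    rcases mem_srcBonds.1 hb' with hadj | rfl
    · refine Finset.mem_map.2 ⟨(p, q, b'.2.2), mem_srcBonds.2 (Or.inl ((hG p q).1 ?_)), hb'eq.symm⟩
      rw [hp, hq]; exact hadj
    · exact Finset.mem_map.2 ⟨b₀, mem_srcBonds.2 (Or.inr rfl), hb⟩


/-- **Transport of the truncated functionals**: `Φ^T(φ C; ρ') = Φ^T(C; ρ)`. [cite: KoteckyPreiss1986, (3) (Φ^T only depends on the polymer system)] -/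
theorem truncatedWeight_srcActivityC_map (hz : atomicPartitionFn (β : ℂ) U μ ≠ 0) (hG : ∀ p q, G'.Adj (φ p) (φ q) ↔ G.Adj p q) (hb : bondMapInj φ b₀ = b₀') (ε : ℂ)
    (C : Finset (Finset Λ)) :
    truncatedWeight polyInc (srcActivityC G' β U μ b₀' ε) (C.map (Finset.mapEmbedding φ).toEmbedding) =
      truncatedWeight polyInc (srcActivityC G β U μ b₀ ε) C := by
  rw [Finset.map_eq_image]
  exact truncatedWeight_image (inc := polyInc) (inc' := polyInc) (Finset.map_injective φ).injOn
    (fun A _ B _ => polyInc_map_iff φ A B) (fun A _ => srcActivityC_map_inj φ hz hG hb ε A)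



/-- **The main parts of two source gases agree under transport.** Let `φ : Λ ↪ Λ'` intertwine the
graphs (`G'.Adj (φ p) (φ q) ↔ G.Adj p q`) and the source bonds, let the degrees of `G'` be `≤ 4`,
`z₀ ≠ 0`, site ratio `≤ 2`, `0 ≤ β ≤ β₁`, `|ε| ≤ β₁`, and let `ht : Λ' → ℕ` grow by at most one along the edges of `G'`, vanish
at the sites of `b₀'`, and have its sub-level set `{ht < R}` inside the range of `φ`. Then the
anchored families of size `< R` of the two gases with non-zero truncated functional correspond
under `φ`, and `srcMainC G' b₀' R ε = srcMainC G b₀ R ε`.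
[cite: Ueltschi1999, proof of Thm. 2.1 (ii) ("the sums converge uniformly in the volume")] -/
theorem srcMainC_eq_of_transport (hdeg' : ∀ v : Λ', (Finset.univ.filter (G'.Adj v)).card ≤ 4)
    (hz : atomicPartitionFn (β : ℂ) U μ ≠ 0) (hr : siteRatio (β : ℂ) U μ ≤ 2) (hβ0 : 0 ≤ β) (hβ : β ≤ betaHTc) {ε : ℂ} (hε : ‖ε‖ ≤ betaHTc)
    (hG : ∀ p q, G'.Adj (φ p) (φ q) ↔ G.Adj p q) (hb : bondMapInj φ b₀ = b₀')
    {ht : Λ' → ℕ} (hlip : ∀ a b, G'.Adj a b → ht b ≤ ht a + 1) (h1 : ht b₀'.1 = 0) (h2 : ht b₀'.2.1 = 0)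
    {R : ℕ} (hR : ∀ u, ht u < R → u ∈ rangeSites φ) :
    srcMainC G' β U μ b₀' R ε = srcMainC G β U μ b₀ R ε := by
  classical
  set ρT := srcActivityC G' β U μ b₀' ε with hρT
  -- the lift of families and its inverse
  set Ψ : Finset (Finset Λ) → Finset (Finset Λ') := fun C => C.map (Finset.mapEmbedding φ).toEmbedding with hΨ
  set Ψi : Finset (Finset Λ') → Finset (Finset Λ) := fun C' => C'.image fun A' => A'.preimage φ φ.injective.injOn with hΨi
  have hΨmem : ∀ (C : Finset (Finset Λ)) (A' : Finset Λ'), A' ∈ Ψ C ↔ ∃ A ∈ C, A.map φ = A' := by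
    intro C A'
    simp only [hΨ, Finset.mem_map, RelEmbedding.coe_toEmbedding, Finset.mapEmbedding_apply]
  have hpreimage_map : ∀ A : Finset Λ, (A.map φ).preimage φ φ.injective.injOn = A := fun A => by
    ext a
    rw [Finset.mem_preimage]
    exact Finset.mem_map' φ
  have hsizeΨ : ∀ C, famSize (Ψ C) = famSize C := fun C => by
    simp only [famSize, hΨ, Finset.sum_map, RelEmbedding.coe_toEmbedding, Finset.mapEmbedding_apply, Finset.card_map]
  have hleft : ∀ C, Ψi (Ψ C) = C := fun C => by
    ext B
    simp only [hΨi, Finset.mem_image]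
    constructor
    · rintro ⟨A', hA', rfl⟩
      obtain ⟨A, hA, rfl⟩ := (hΨmem C A').1 hA'
      rwa [hpreimage_map]
    · intro hB
      exact ⟨B.map φ, (hΨmem C _).2 ⟨B, hB, rfl⟩, hpreimage_map B⟩
  have hright : ∀ C' : Finset (Finset Λ'), clusterSupp C' ⊆ rangeSites φ → Ψ (Ψi C') = C' := fun C' hsupp => by
    have hpre : ∀ A'' ∈ C', (A''.preimage φ φ.injective.injOn).map φ = A'' := fun A'' hA'' =>
      map_preimage_of_subset_rangeSites φ ((subset_clusterSupp hA'').trans hsupp)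
    ext A'
    rw [hΨmem]
    simp only [hΨi, Finset.mem_image]
    constructor
    · rintro ⟨B, ⟨A'', hA'', rfl⟩, rfl⟩
      rwa [hpre A'' hA'']
    · intro hA'
      exact ⟨_, ⟨A', hA', rfl⟩, hpre A' hA'⟩
  -- index sets
  set T := ((srcFamilies b₀').filter (fun C => famSize C < R)).filter (fun C' => clusterSupp C' ⊆ rangeSites φ) with hT
  -- the main part of `G'` only involves families supported in the range
  have hsupp_of_ne : ∀ C' ∈ (srcFamilies b₀').filter (fun C => famSize C < R), truncatedWeight polyInc ρT C' ≠ 0 →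
      clusterSupp C' ⊆ rangeSites φ := by
    intro C' hC' hne w hw
    obtain ⟨hC', hsize⟩ := Finset.mem_filter.1 hC'
    exact hR w ((height_lt_of_mem_srcFamiliesC hdeg' hz hr hβ0 hβ hε hlip h1 h2 hC' hne hw).trans hsize)
  have hLHS : srcMainC G' β U μ b₀' R ε = ∑ C' ∈ T, truncatedWeight polyInc ρT C' := by
    rw [hT]
    symm
    rw [Finset.sum_filter_of_ne hsupp_of_ne]
    rfl
  rw [hLHS, srcMainC]
  symm
  refine Finset.sum_nbij' Ψ Ψi (fun C hC => ?_) (fun C' hC' => ?_) (fun C _ => hleft C) (fun C' hC' => ?_) (fun C _ => ?_)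
  · -- `Ψ C ∈ T`
    obtain ⟨hCfam, hCsize⟩ := Finset.mem_filter.1 hC
    obtain ⟨A, hAC, hA⟩ := mem_srcFamilies.1 hCfam
    refine Finset.mem_filter.2 ⟨Finset.mem_filter.2 ⟨mem_srcFamilies.2 ⟨A.map φ, (hΨmem C _).2 ⟨A, hAC, rfl⟩, ?_, ?_⟩, ?_⟩, ?_⟩
    · rw [← hb, bondMapInj_apply]; exact Finset.mem_map_of_mem φ hA.1
    · rw [← hb, bondMapInj_apply]; exact Finset.mem_map_of_mem φ hA.2
    · rw [hsizeΨ]; exact hCsize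
    · intro w hw
      obtain ⟨A', hA', hwA'⟩ := mem_clusterSupp.1 hw
      obtain ⟨B, -, rfl⟩ := (hΨmem C A').1 hA'
      obtain ⟨b, -, rfl⟩ := Finset.mem_map.1 hwA'
      exact Finset.mem_map_of_mem φ (Finset.mem_univ b)
  · -- `Ψi C' ∈ S`
    obtain ⟨hC'1, hsupp⟩ := Finset.mem_filter.1 hC'
    obtain ⟨hC'fam, hC'size⟩ := Finset.mem_filter.1 hC'1
    obtain ⟨A', hA'C', hA'⟩ := mem_srcFamilies.1 hC'fam
    refine Finset.mem_filter.2 ⟨mem_srcFamilies.2 ⟨A'.preimage φ φ.injective.injOn, Finset.mem_image_of_mem _ hA'C', ?_, ?_⟩, ?_⟩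
    · rw [Finset.mem_preimage]
      have hh := hA'.1
      rw [← hb, bondMapInj_apply] at hh
      exact hh
    · rw [Finset.mem_preimage]
      have hh := hA'.2
      rw [← hb, bondMapInj_apply] at hh
      exact hh
    · rw [← hsizeΨ, hright C' hsupp]
      exact hC'size
  · -- right inverse
    exact hright C' (Finset.mem_filter.1 hC').2
  · -- the terms agree
    exact (truncatedWeight_srcActivityC_map φ hz hG hb ε C).symm

end Transport

section Torus

variable {β : ℝ} {U μ : ℂ}

-----TORUS-----
/-- **The main parts of the torus and of the comparison box agree** for `L > 2M + 1`, `z₀ ≠ 0`, site ratio `≤ 2`,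
`0 ≤ β ≤ β₁`, `|ε| ≤ β₁` (`srcMainC_eq_of_transport` along the lift, with the torus distance to `{0̄, ȳ}` as
height). [cite: Ueltschi1999, proof of Thm. 2.1 (ii) ("the sums converge uniformly in the volume")] -/
theorem srcMainC_torus_eq_plane {L : ℕ} [NeZero L] {R : ℕ} {y : Site 2} {σ : Fin 2} (hL : 2 * Mbox R y + 1 < L)
    (hz : atomicPartitionFn (β : ℂ) U μ ≠ 0) (hr : siteRatio (β : ℂ) U μ ≤ 2) (hβ0 : 0 ≤ β) (hβ : β ≤ betaHTc) {ε : ℂ} (hε : ‖ε‖ ≤ betaHTc) :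
    srcMainC (fermionTorusGraph 2 L) β U μ (torusSrc L y σ) R ε = srcMainC (polyGraph (box 2 (Mbox R y))) β U μ (planeSrc R y σ) R ε :=
  srcMainC_eq_of_transport (liftEmb L R y (Nat.lt_of_succ_lt hL)) (degree_torus_le L) hz hr hβ0 hβ hε (liftEmb_adj_iff hL)
    (bondMapInj_liftEmb_planeSrc _ σ) (fun _ _ hab => torusHt_le_succ_of_adj y hab) (torusHt_torusPt_zero y) (torusHt_torusPt_self y)
    fun _ hu => mem_rangeSites_of_torusHt_lt _ hu


end Torus

/-! ### Uniformity in the volume for complex parameters -/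

section Limit

variable {β : ℝ} {U μ : ℂ}

/-- The torus two-point function for complex parameters (junk value `0` at `L = 0`). [cite: Ueltschi1999, §2.1] -/
def twoPtTorusC (β : ℝ) (U μ : ℂ) (L : ℕ) (y : Site 2) (σ : Fin 2) : ℂ :=
  if h : L = 0 then 0 else
    haveI : NeZero L := ⟨h⟩
    twoPtC (fermionTorusGraph 2 L) β U μ (torusSrc L y σ)

/-- `twoPtTorusC` on a torus of positive side. [folklore] -/
theorem twoPtTorusC_of_neZero (β : ℝ) (U μ : ℂ) (L : ℕ) [NeZero L] (y : Site 2) (σ : Fin 2) :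
    twoPtTorusC β U μ L y σ = twoPtC (fermionTorusGraph 2 L) β U μ (torusSrc L y σ) := by
  unfold twoPtTorusC
  rw [dif_neg (NeZero.ne L)]

/-- On the torus at real parameters, `twoPtC` is the thermal two-point function of the fact.
[cite: Ueltschi1999, §2.1 (Gibbs state ⟨K⟩)] -/
theorem twoPtC_torus_ofReal (β U μ : ℝ) (L : ℕ) [NeZero L] (y : Site 2) (σ : Fin 2) :
    twoPtC (fermionTorusGraph 2 L) β (U : ℂ) (μ : ℂ) (torusSrc L y σ) = hubbardThermalTwoPoint β U μ L 0 y σ σ := by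
  have h := thermalCorr_creation_annihilation_eq_deriv_div (fermionTorusGraph 2 L) β 1 U μ (torusPt L 0) (torusPt L y) σ
  simp only [Complex.ofReal_one, mul_one] at h
  symm
  rw [twoPtC]
  simp only [srcCoupling, torusSrc, zero_smul, add_zero]
  unfold hubbardThermalTwoPoint
  rw [dif_neg (NeZero.ne L)]
  -- `convert`, not `exact`: the `DecidableEq` instance terms synthesised inside the definition of
  -- `hubbardThermalTwoPoint` differ syntactically from those of the generic identity `h`
  convert h using 2
  all_goals rfl

/-- **At real parameters the complex two-point function is the thermal expectation of the fact.**
[cite: Ueltschi1999, §2.1 (Gibbs state ⟨K⟩)] -/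
theorem twoPtTorusC_ofReal (β U μ : ℝ) (L : ℕ) (y : Site 2) (σ : Fin 2) :
    twoPtTorusC β (U : ℂ) (μ : ℂ) L y σ = hubbardThermalTwoPoint β U μ L 0 y σ σ := by
  by_cases hL : L = 0
  · subst hL
    unfold twoPtTorusC hubbardThermalTwoPoint
    simp
  · haveI : NeZero L := ⟨hL⟩
    rw [twoPtTorusC_of_neZero, twoPtC_torus_ofReal]

/-- **Uniformity in the volume for complex parameters**: for admissible `(U, μ)`, `0 ≤ β ≤ β₁`,
`|ε| ≤ β₁` and `L, L' > 2(R + ‖y‖_∞) + 1`,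
`|(F_L(ε) - F_L(0)) - (F_{L'}(ε) - F_{L'}(0))| ≤ 4 e^{-R}`. [cite: Ueltschi1999, proof of Thm. 2.1 (ii)] -/
theorem norm_srcLogZC_sub_sub_le (hz : atomicPartitionFn (β : ℂ) U μ ≠ 0) (hr : siteRatio (β : ℂ) U μ ≤ 2)
    (hβ0 : 0 ≤ β) (hβ : β ≤ betaHTc) {ε : ℂ} (hε : ‖ε‖ ≤ betaHTc) (y : Site 2) (σ : Fin 2) (R : ℕ)
    {L L' : ℕ} [NeZero L] [NeZero L'] (hL : 2 * Mbox R y + 1 < L) (hL' : 2 * Mbox R y + 1 < L') :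
    ‖(srcLogZC (fermionTorusGraph 2 L) β U μ (torusSrc L y σ) ε - srcLogZC (fermionTorusGraph 2 L) β U μ (torusSrc L y σ) 0) -
      (srcLogZC (fermionTorusGraph 2 L') β U μ (torusSrc L' y σ) ε - srcLogZC (fermionTorusGraph 2 L') β U μ (torusSrc L' y σ) 0)‖ ≤
      4 * Real.exp (-R) := by
  have h0 : ‖(0 : ℂ)‖ ≤ betaHTc := by rw [norm_zero]; exact betaHTc_pos.le
  rw [srcLogZC_sub_eq_main_add_tail R, srcLogZC_sub_eq_main_add_tail R, srcMainC_torus_eq_plane hL hz hr hβ0 hβ hε,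
    srcMainC_torus_eq_plane hL hz hr hβ0 hβ h0, srcMainC_torus_eq_plane hL' hz hr hβ0 hβ hε, srcMainC_torus_eq_plane hL' hz hr hβ0 hβ h0]
  have t1 := norm_srcTailC_le (U := U) (μ := μ) (b₀ := torusSrc L y σ) (degree_torus_le L) hz hr hβ0 hβ hε R
  have t2 := norm_srcTailC_le (U := U) (μ := μ) (b₀ := torusSrc L y σ) (degree_torus_le L) hz hr hβ0 hβ h0 R
  have t3 := norm_srcTailC_le (U := U) (μ := μ) (b₀ := torusSrc L' y σ) (degree_torus_le L') hz hr hβ0 hβ hε R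
  have t4 := norm_srcTailC_le (U := U) (μ := μ) (b₀ := torusSrc L' y σ) (degree_torus_le L') hz hr hβ0 hβ h0 R
  calc _ = ‖(srcTailC (fermionTorusGraph 2 L) β U μ (torusSrc L y σ) R ε - srcTailC (fermionTorusGraph 2 L) β U μ (torusSrc L y σ) R 0) -
        (srcTailC (fermionTorusGraph 2 L') β U μ (torusSrc L' y σ) R ε - srcTailC (fermionTorusGraph 2 L') β U μ (torusSrc L' y σ) R 0)‖ := by
          congr 1; ring
    _ ≤ (‖srcTailC (fermionTorusGraph 2 L) β U μ (torusSrc L y σ) R ε‖ + ‖srcTailC (fermionTorusGraph 2 L) β U μ (torusSrc L y σ) R 0‖) +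
        (‖srcTailC (fermionTorusGraph 2 L') β U μ (torusSrc L' y σ) R ε‖ + ‖srcTailC (fermionTorusGraph 2 L') β U μ (torusSrc L' y σ) R 0‖) :=
          (norm_sub_le _ _).trans (add_le_add (norm_sub_le _ _) (norm_sub_le _ _))
    _ ≤ (Real.exp (-R) + Real.exp (-R)) + (Real.exp (-R) + Real.exp (-R)) := add_le_add (add_le_add t1 t2) (add_le_add t3 t4)
    _ = 4 * Real.exp (-R) := by ring

/-- **The Cauchy estimate, uniformly in admissible complex parameters**:
`|twoPt_L - twoPt_{L'}| ≤ 4e^{-R}/(β₁/2)` for `L, L' > 2(R + ‖y‖_∞) + 1`. [cite: Ueltschi1999, proof of Thm. 2.1 (ii)] -/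
theorem norm_twoPtC_sub_le (hz : atomicPartitionFn (β : ℂ) U μ ≠ 0) (hr : siteRatio (β : ℂ) U μ ≤ 2)
    (hβ0 : 0 ≤ β) (hβ : β ≤ betaHTc) (y : Site 2) (σ : Fin 2) (R : ℕ)
    {L L' : ℕ} [NeZero L] [NeZero L'] (hL : 2 * Mbox R y + 1 < L) (hL' : 2 * Mbox R y + 1 < L') :
    ‖twoPtC (fermionTorusGraph 2 L) β U μ (torusSrc L y σ) - twoPtC (fermionTorusGraph 2 L') β U μ (torusSrc L' y σ)‖ ≤
      4 * Real.exp (-R) / (betaHTc / 2) := by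
  set F : ℂ → ℂ := srcLogZC (fermionTorusGraph 2 L) β U μ (torusSrc L y σ) with hF
  set F' : ℂ → ℂ := srcLogZC (fermionTorusGraph 2 L') β U μ (torusSrc L' y σ) with hF'
  set g : ℂ → ℂ := fun ε => (F ε - F 0) - (F' ε - F' 0) with hg
  have hrad : 0 < betaHTc / 2 := half_pos betaHTc_pos
  have hball : Metric.ball (0 : ℂ) betaHTc ∈ 𝓝 (0 : ℂ) := Metric.ball_mem_nhds 0 betaHTc_pos
  have hFd : DifferentiableOn ℂ F (Metric.ball 0 betaHTc) := differentiableOn_srcLogZC (degree_torus_le L) hz hr hβ0 hβ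
  have hF'd : DifferentiableOn ℂ F' (Metric.ball 0 betaHTc) := differentiableOn_srcLogZC (degree_torus_le L') hz hr hβ0 hβ
  have hgd : DifferentiableOn ℂ g (Metric.ball 0 betaHTc) :=
    (hFd.sub (differentiableOn_const _)).sub (hF'd.sub (differentiableOn_const _))
  have hclosed : Metric.closedBall (0 : ℂ) (betaHTc / 2) ⊆ Metric.ball 0 betaHTc :=
    Metric.closedBall_subset_ball (by linarith [betaHTc_pos])
  have hdiff : DiffContOnCl ℂ g (Metric.ball 0 (betaHTc / 2)) := hgd.diffContOnCl_ball hclosed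
  have hbound : ∀ z ∈ Metric.sphere (0 : ℂ) (betaHTc / 2), ‖g z‖ ≤ 4 * Real.exp (-R) := by
    intro z hz'
    have hz'' : ‖z‖ ≤ betaHTc := by
      rw [mem_sphere_zero_iff_norm] at hz'
      rw [hz']; linarith [betaHTc_pos]
    exact norm_srcLogZC_sub_sub_le hz hr hβ0 hβ hz'' y σ R hL hL'
  have hderiv : deriv g 0 = twoPtC (fermionTorusGraph 2 L) β U μ (torusSrc L y σ) - twoPtC (fermionTorusGraph 2 L') β U μ (torusSrc L' y σ) := by
    have hF0 : HasDerivAt F (deriv F 0) 0 := (hFd.differentiableAt hball).hasDerivAt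
    have hF'0 : HasDerivAt F' (deriv F' 0) 0 := (hF'd.differentiableAt hball).hasDerivAt
    have hg0 : HasDerivAt g (deriv F 0 - deriv F' 0) 0 := (hF0.sub_const (F 0)).sub (hF'0.sub_const (F' 0))
    rw [hg0.deriv, hF, hF', deriv_srcLogZC_zero (degree_torus_le L) hz hr hβ0 hβ, deriv_srcLogZC_zero (degree_torus_le L') hz hr hβ0 hβ]
  rw [← hderiv]
  exact Complex.norm_deriv_le_of_forall_mem_sphere_norm_le hrad hdiff hbound

/-- The same with the junk-free torus function and an explicit threshold: for every `R` and all
`L, L' ≥ 2(R + ‖y‖_∞) + 2`. [cite: Ueltschi1999, proof of Thm. 2.1 (ii)] -/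
theorem norm_twoPtTorusC_sub_le (hz : atomicPartitionFn (β : ℂ) U μ ≠ 0) (hr : siteRatio (β : ℂ) U μ ≤ 2)
    (hβ0 : 0 ≤ β) (hβ : β ≤ betaHTc) (y : Site 2) (σ : Fin 2) (R : ℕ) {L L' : ℕ}
    (hL : 2 * Mbox R y + 2 ≤ L) (hL' : 2 * Mbox R y + 2 ≤ L') :
    ‖twoPtTorusC β U μ L y σ - twoPtTorusC β U μ L' y σ‖ ≤ 4 * Real.exp (-R) / (betaHTc / 2) := by
  haveI : NeZero L := ⟨by omega⟩
  haveI : NeZero L' := ⟨by omega⟩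
  rw [twoPtTorusC_of_neZero, twoPtTorusC_of_neZero]
  exact norm_twoPtC_sub_le hz hr hβ0 hβ y σ R (by omega) (by omega)

/-- The bound `4e^{-R}/(β₁/2)` tends to `0`. [folklore] -/
theorem tendsto_cauchyBound : Tendsto (fun R : ℕ => 4 * Real.exp (-(R : ℝ)) / (betaHTc / 2)) atTop (𝓝 0) := by
  have h := (Real.tendsto_exp_neg_atTop_nhds_zero.comp tendsto_natCast_atTop_atTop)
  have := (h.const_mul 4).div_const (betaHTc / 2)
  simpa using this

/-- **The two-point function converges for admissible complex parameters.** [cite: Ueltschi1999, Thm. 2.1 (ii)] -/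
theorem cauchySeq_twoPtTorusC (hz : atomicPartitionFn (β : ℂ) U μ ≠ 0) (hr : siteRatio (β : ℂ) U μ ≤ 2)
    (hβ0 : 0 ≤ β) (hβ : β ≤ betaHTc) (y : Site 2) (σ : Fin 2) :
    CauchySeq fun L : ℕ => twoPtTorusC β U μ L y σ := by
  refine Metric.cauchySeq_iff'.2 fun η hη => ?_
  obtain ⟨R, hR⟩ := (tendsto_cauchyBound.eventually (gt_mem_nhds hη)).exists
  refine ⟨2 * Mbox R y + 2, fun n hn => ?_⟩
  rw [dist_eq_norm]
  exact (norm_twoPtTorusC_sub_le hz hr hβ0 hβ y σ R hn le_rfl).trans_lt hR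

end Limit

/-! ### Holomorphy in the coupling -/

section Strip

variable {β : ℝ}

/-- The thermodynamic limit of the complex-coupling two-point function (a `limUnder`), as a
function of `U ∈ ℂ` at fixed real `β, μ`. [cite: Ueltschi1999, Thm. 2.1 (i)–(ii)] -/
def htTwoPointLimitC (β μ : ℝ) (σ : Fin 2) (y : Site 2) (U : ℂ) : ℂ :=
  limUnder atTop fun L : ℕ => twoPtTorusC β U (μ : ℂ) L y σ

/-- On the strip the finite-volume functions converge to `htTwoPointLimitC`. [cite: Ueltschi1999, Thm. 2.1 (ii)] -/
theorem tendsto_htTwoPointLimitC (hβ0 : 0 ≤ β) (hβ : β ≤ betaHTc) (μ : ℝ) (σ : Fin 2) (y : Site 2) {U : ℂ} (hU : U ∈ strip β) :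
    Tendsto (fun L : ℕ => twoPtTorusC β U (μ : ℂ) L y σ) atTop (𝓝 (htTwoPointLimitC β μ σ y U)) := by
  obtain ⟨hz, hr⟩ := admissible_of_mem_strip μ hU
  exact tendsto_nhds_limUnder (cauchySeq_tendsto_of_complete (cauchySeq_twoPtTorusC hz hr hβ0 hβ y σ))

/-- **Uniform convergence on the strip.** [cite: Ueltschi1999, proof of Thm. 2.1 (ii) ("uniformly")] -/
theorem tendstoUniformlyOn_twoPtTorusC (hβ0 : 0 ≤ β) (hβ : β ≤ betaHTc) (μ : ℝ) (σ : Fin 2) (y : Site 2) :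
    TendstoUniformlyOn (fun (L : ℕ) (U : ℂ) => twoPtTorusC β U (μ : ℂ) L y σ) (htTwoPointLimitC β μ σ y) atTop (strip β) := by
  refine UniformCauchySeqOn.tendstoUniformlyOn_of_tendsto ?_ fun U hU => tendsto_htTwoPointLimitC hβ0 hβ μ σ y hU
  refine Metric.uniformCauchySeqOn_iff.2 fun η hη => ?_
  obtain ⟨R, hR⟩ := (tendsto_cauchyBound.eventually (gt_mem_nhds hη)).exists
  refine ⟨2 * Mbox R y + 2, fun m hm n hn U hU => ?_⟩
  obtain ⟨hz, hr⟩ := admissible_of_mem_strip μ hU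
  rw [dist_eq_norm]
  exact (norm_twoPtTorusC_sub_le hz hr hβ0 hβ y σ R hm hn).trans_lt hR

variable {Λ : Type*} [LinearOrder Λ] [Fintype Λ] {G : SimpleGraph Λ} [DecidableRel G.Adj]

/-- **Holomorphy of the finite-volume two-point function in the coupling**: on any finite graph of
degrees `≤ 4`, `U ↦ twoPtC G β U μ b₀` is complex-differentiable on the strip (a quotient of entire
functions of `U` — traces of `exp` of a matrix affine in `U` — whose denominator does not vanish
there). [cite: Ueltschi1999, Thm. 2.1 (i) (analyticity in the parameters)] -/
theorem differentiableOn_twoPtC (hdeg : ∀ v : Λ, (Finset.univ.filter (G.Adj v)).card ≤ 4) (hβ0 : 0 ≤ β) (hβ : β ≤ betaHTc)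
    (μ : ℝ) (b₀ : Bond Λ) :
    DifferentiableOn ℂ (fun U : ℂ => twoPtC G β U (μ : ℂ) b₀) (strip β) := by
  -- `X(U) = A₀ + U • Y`
  set Y : Matrix (Finset (Orb Λ)) (Finset (Orb Λ)) ℂ := -((β : ℂ) • nnSum (Finset.univ : Finset Λ)) with hY
  set A₀ : Matrix (Finset (Orb Λ)) (Finset (Orb Λ)) ℂ :=
    ((β : ℂ) * (μ : ℂ)) • nSum (Finset.univ : Finset Λ) + hopSum (hubbardCoupling G (β : ℂ)) with hA₀
  have hX : ∀ U : ℂ, -((β : ℂ) • onSiteSum U (μ : ℂ) (Finset.univ : Finset Λ)) + hopSum (hubbardCoupling G (β : ℂ)) = A₀ + U • Y := by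
    intro U
    rw [onSiteSum_eq_smul_sub_smul, hA₀, hY, smul_sub, smul_smul, smul_smul, smul_neg, smul_smul, mul_comm U (β : ℂ)]
    abel
  have hnum : Differentiable ℂ fun U : ℂ => (NormedSpace.exp (A₀ + U • Y) * bondOp b₀).trace := by
    intro U
    set Lm : Matrix (Finset (Orb Λ)) (Finset (Orb Λ)) ℂ →L[ℂ] ℂ :=
      LinearMap.toContinuousLinearMap ((Matrix.traceLinearMap _ ℂ ℂ) ∘ₗ (LinearMap.mulRight ℂ (bondOp b₀))) with hLm
    have h := (Lm.hasFDerivAt.comp_hasDerivAt U (Matrix.hasDerivAt_exp_add_smul_complex A₀ Y U)).differentiableAt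
    exact h
  have hden : Differentiable ℂ fun U : ℂ => (NormedSpace.exp (A₀ + U • Y)).trace :=
    fun U => (Matrix.hasDerivAt_trace_exp_add_smul_complex A₀ Y U).differentiableAt
  have hne : ∀ U ∈ strip β, (NormedSpace.exp (A₀ + U • Y)).trace ≠ 0 := by
    intro U hU
    obtain ⟨hz, hr⟩ := admissible_of_mem_strip μ hU
    have h := Zc_srcCoupling_zero_ne_zero (G := G) (b₀ := b₀) hdeg hz hr hβ0 hβ
    rwa [Zc, srcCoupling, zero_smul, add_zero, hX U] at h
  have heq : ∀ U : ℂ, twoPtC G β U (μ : ℂ) b₀ = (NormedSpace.exp (A₀ + U • Y) * bondOp b₀).trace / (NormedSpace.exp (A₀ + U • Y)).trace := by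
    intro U
    rw [twoPtC_eq_trace_div, hX U]
  simp_rw [heq]
  exact (hnum.differentiableOn).div hden.differentiableOn hne

/-- The torus functions are holomorphic on the strip (`L ≥ 1`). [cite: Ueltschi1999, Thm. 2.1 (i)] -/
theorem differentiableOn_twoPtTorusC (hβ0 : 0 ≤ β) (hβ : β ≤ betaHTc) (μ : ℝ) (L : ℕ) (y : Site 2) (σ : Fin 2) :
    DifferentiableOn ℂ (fun U : ℂ => twoPtTorusC β U (μ : ℂ) L y σ) (strip β) := by
  by_cases hL : L = 0
  · subst hL
    have h : (fun U : ℂ => twoPtTorusC β U (μ : ℂ) 0 y σ) = fun _ => 0 := by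
      funext U; unfold twoPtTorusC; simp
    rw [h]
    exact differentiableOn_const _
  · haveI : NeZero L := ⟨hL⟩
    simp_rw [twoPtTorusC_of_neZero]
    exact differentiableOn_twoPtC (degree_torus_le L) hβ0 hβ μ _

/-- **Holomorphy of the infinite-volume two-point function in the coupling at high temperature**:
for real `0 ≤ β ≤ β₁`, real `μ`, the thermodynamic limit `U ↦ S_{β,U,μ,σ}(y)` is
complex-differentiable on the strip `|β Im U| < π/3` (uniform limit of holomorphic functions).
[cite: Ueltschi1999, Thm. 2.1 (i)–(ii)] -/
theorem differentiableOn_htTwoPointLimitC (hβ0 : 0 ≤ β) (hβ : β ≤ betaHTc) (μ : ℝ) (σ : Fin 2) (y : Site 2) :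
    DifferentiableOn ℂ (htTwoPointLimitC β μ σ y) (strip β) :=
  (tendstoUniformlyOn_twoPtTorusC hβ0 hβ μ σ y).tendstoLocallyUniformlyOn.differentiableOn
    (Filter.Eventually.of_forall fun L => differentiableOn_twoPtTorusC hβ0 hβ μ L y σ) (isOpen_strip β)

/-- Hence it is analytic on the strip. [cite: Ueltschi1999, Thm. 2.1 (i)] -/
theorem analyticOnNhd_htTwoPointLimitC (hβ0 : 0 ≤ β) (hβ : β ≤ betaHTc) (μ : ℝ) (σ : Fin 2) (y : Site 2) :
    AnalyticOnNhd ℂ (htTwoPointLimitC β μ σ y) (strip β) :=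
  (differentiableOn_htTwoPointLimitC hβ0 hβ μ σ y).analyticOnNhd (isOpen_strip β)

/-- **It extends the real high-temperature two-point function**: at real `U`,
`htTwoPointLimitC β μ σ y U = htTwoPointLimit β U μ σ y`. [cite: Ueltschi1999, Thm. 2.1 (ii)] -/
theorem htTwoPointLimitC_ofReal (hβ0 : 0 ≤ β) (hβ : β ≤ betaHTc) (μ : ℝ) (σ : Fin 2) (y : Site 2) (U : ℝ) :
    htTwoPointLimitC β μ σ y (U : ℂ) = htTwoPointLimit β U μ σ y := by
  have h1 := tendsto_htTwoPointLimitC hβ0 hβ μ σ y (ofReal_mem_strip β U)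
  have h2 := tendsto_htTwoPointLimit hβ0 (hβ.trans betaHTc_le_betaHT) U μ σ y
  simp_rw [twoPtTorusC_ofReal] at h1
  exact tendsto_nhds_unique h1 h2

/-- **Convergent perturbation theory in `U` at high temperature**: for `0 < β ≤ β₁` the
infinite-volume two-point function has a power series in `U` at `U = 0` converging on every disc
`|U| < r` with `r < π/(3β)`. [cite: BenfattoGiulianiMastropietro2006, §1.3 (the naive expansion's radius ε_β = [Cβ^α]⁻¹)] -/
theorem hasFPowerSeriesOnBall_htTwoPointLimitC (hβ0 : 0 < β) (hβ : β ≤ betaHTc) (μ : ℝ) (σ : Fin 2) (y : Site 2)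
    {r : NNReal} (hr0 : 0 < r) (hr : (r : ℝ) < Real.pi / 3 / β) :
    HasFPowerSeriesOnBall (htTwoPointLimitC β μ σ y) (cauchyPowerSeries (htTwoPointLimitC β μ σ y) 0 r) 0 r := by
  refine DifferentiableOn.hasFPowerSeriesOnBall ?_ hr0
  refine (differentiableOn_htTwoPointLimitC hβ0.le hβ μ σ y).mono ?_
  exact (Metric.closedBall_subset_ball hr).trans (ball_subset_strip hβ0)

end Strip

end SourceGasC

end Literature.MathematicalPhysics.QuantumLattice

end
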